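import Literature.Geometry.Lorentzian.PseudoRiemannianMetric
import Mathlib.LinearAlgebra.Trace
import HarnessLib

/-!
# The metric adjoint of an endomorphism and trace identities for metric contractions

Fibrewise linear algebra for a pseudo-Riemannian metric `g` (`PseudoRiemannianMetric.lean`): the
`g`-adjoint `A† = ♯ ∘ A^* ∘ ♭` of an endomorphism `A` of a fibre (`g(A v, w) = g(v, A† w)`,
`val_apply_eq_val_adjoint`; written out, not introduced as a definition), `tr A† = tr A`
(`trace_adjoint`), `(♯S)† = ♯Sᵗ` for the endomorphism `♯S : v ↦ ♯(S(v, ·))` of a bilinear form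
(`adjoint_sharp_comp`), whence the transposition invariance of the double contraction
`tr(♯S ∘ ♯T) = tr(♯Tᵗ ∘ ♯Sᵗ)` (`trace_sharp_comp_sharp_eq_flip`) and the identity used to
contract Chruściel–Costa's (7.1) `D_i Z_j + D_j Z_i = -2N K_{ij}` with `K^{ij}`: for `K`
symmetric and `B + Bᵗ = c K`, `tr(♯K ∘ ♯B) = (c/2) |K|²_g`
(`trace_sharp_comp_sharp_of_add_flip_eq`; with `B_{ij} = D_i Z_j`, `c = -2N`:
`K^{ij} D_i Z_j = -N K^{ij} K_{ij}`, Chruściel–Costa 2008, §7.2). O'Neill 1983, Ch. 3, pp. 60–61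
(metric equivalence of tensors of type (1,1) and (0,2), metric contraction).

Everything is proved; no definitions, no named facts.

## References

* B. O'Neill, *Semi-Riemannian geometry with applications to relativity*, Academic Press 1983,
  Ch. 3, pp. 60–61 (key `ONeill1983`).
* P. T. Chruściel, J. L. Costa, *On uniqueness of stationary vacuum black holes*, Astérisque 321
  (2008), §7.2 (key `ChruscielCosta2008`).
-/

open Manifold Bundle
open scoped ContDiff Topology

noncomputable section

namespace Literature.Geometry.Lorentzian

namespace PseudoRiemannianMetric

variable
  {EB : Type*} [NormedAddCommGroup EB] [NormedSpace ℝ EB]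
  {HB : Type*} [TopologicalSpace HB] {IB : ModelWithCorners ℝ EB HB} {n : ℕ∞ω}
  {B : Type*} [TopologicalSpace B] [ChartedSpace HB B]
  {F : Type*} [NormedAddCommGroup F] [NormedSpace ℝ F]
  {E : B → Type*} [TopologicalSpace (TotalSpace F E)]
  [∀ b, TopologicalSpace (E b)] [∀ b, AddCommGroup (E b)] [∀ b, Module ℝ (E b)]
  [FiberBundle F E] [VectorBundle ℝ F E] [FiniteDimensional ℝ F]
  (g : PseudoRiemannianMetric IB n F E) (b : B)

omit [FiniteDimensional ℝ F] in
/-- Two endomorphisms with the same matrix elements `g(v, P w) = g(v, Q w)` are equal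
(nondegeneracy). [folklore] -/
theorem endo_eq_of_forall_val_eq {P Q : E b →ₗ[ℝ] E b}
    (h : ∀ v w, g.val b v (P w) = g.val b v (Q w)) : P = Q := by
  refine LinearMap.ext fun w ↦ ?_
  have h0 : ∀ v, g.val b (P w - Q w) v = 0 := fun v ↦ by
    have e : g.val b (P w - Q w) v = g.val b (P w) v - g.val b (Q w) v := by rw [map_sub]; rfl
    rw [e, g.symm b (P w) v, g.symm b (Q w) v, h v w, sub_self]
  exact sub_eq_zero.1 (g.nondegenerate b _ h0)

/-- `♭ = ♯⁻¹` as linear maps. [folklore] -/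
theorem flat_eq_sharp_symm :
    (g.flat b : E b →ₗ[ℝ] Module.Dual ℝ (E b)) = ((g.sharp b).symm : E b →ₗ[ℝ] Module.Dual ℝ (E b)) := by
  refine LinearMap.ext fun v ↦ (g.sharp b).injective ?_
  rw [sharp_flat]
  exact ((g.sharp b).apply_symm_apply v).symm

/-- **The `g`-adjoint `A† = ♯ ∘ A^* ∘ ♭` of an endomorphism satisfies `g(A v, w) = g(v, A† w)`.**
O'Neill 1983, Ch. 3, p. 60 (metric equivalence of tensors). [cite: ONeill1983, Ch. 3, p. 60] -/
theorem val_apply_eq_val_adjoint (A : E b →ₗ[ℝ] E b) (v w : E b) :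
    g.val b (A v) w =
      g.val b v (((g.sharp b).toLinearMap ∘ₗ A.dualMap ∘ₗ g.flat b) w) := by
  rw [g.symm b v, LinearMap.comp_apply, LinearMap.comp_apply, LinearEquiv.coe_coe,
    val_sharp_apply, LinearMap.dualMap_apply, flat_apply, g.symm b w]

/-- **`tr A† = tr A`.** The adjoint is `♯`-conjugate to the transpose, and both conjugation and
transposition preserve the trace. [folklore] -/
theorem trace_adjoint (A : E b →ₗ[ℝ] E b) :
    LinearMap.trace ℝ (E b) ((g.sharp b).toLinearMap ∘ₗ A.dualMap ∘ₗ g.flat b) =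
      LinearMap.trace ℝ (E b) A := by
  haveI := VectorBundle.finiteDimensional ℝ F E b
  rw [flat_eq_sharp_symm]
  have h : (g.sharp b).toLinearMap ∘ₗ A.dualMap ∘ₗ ((g.sharp b).symm : E b →ₗ[ℝ] Module.Dual ℝ (E b)) =
      (g.sharp b).conj A.dualMap := by
    rw [LinearEquiv.conj_apply]; rfl
  rw [h, LinearMap.trace_conj']
  exact LinearMap.trace_transpose' A

/-- **`(♯S)† = ♯(Sᵗ)`**: the adjoint of the endomorphism `v ↦ ♯(S(v, ·))` of a bilinear form is the
endomorphism of the flipped form. [cite: ONeill1983, Ch. 3, p. 60] -/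
theorem adjoint_sharp_comp (S : LinearMap.BilinForm ℝ (E b)) :
    (g.sharp b).toLinearMap ∘ₗ ((g.sharp b).toLinearMap ∘ₗ S).dualMap ∘ₗ g.flat b =
      (g.sharp b).toLinearMap ∘ₗ S.flip := by
  refine g.endo_eq_of_forall_val_eq b fun v w ↦ ?_
  rw [← val_apply_eq_val_adjoint, LinearMap.comp_apply, LinearEquiv.coe_coe, val_sharp_apply,
    g.symm b v, LinearMap.comp_apply, LinearEquiv.coe_coe, val_sharp_apply]
  rfl

/-- **`tr(♯S ∘ ♯T) = tr(♯Tᵗ ∘ ♯Sᵗ)`** (`= tr((♯S ∘ ♯T)†)`): the metric contraction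
`S_i{}^k T_k{}^i` is invariant under simultaneous transposition. [cite: ONeill1983, Ch. 3, pp. 60–61] -/
theorem trace_sharp_comp_sharp_eq_flip (S T : LinearMap.BilinForm ℝ (E b)) :
    LinearMap.trace ℝ (E b) (((g.sharp b).toLinearMap ∘ₗ S) ∘ₗ ((g.sharp b).toLinearMap ∘ₗ T)) =
      LinearMap.trace ℝ (E b)
        (((g.sharp b).toLinearMap ∘ₗ T.flip) ∘ₗ ((g.sharp b).toLinearMap ∘ₗ S.flip)) := by
  rw [← g.trace_adjoint b (((g.sharp b).toLinearMap ∘ₗ S) ∘ₗ ((g.sharp b).toLinearMap ∘ₗ T))]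
  congr 1
  refine g.endo_eq_of_forall_val_eq b fun v w ↦ ?_
  rw [← val_apply_eq_val_adjoint]
  simp only [LinearMap.comp_apply, LinearEquiv.coe_coe, val_sharp_apply]
  have e1 : T.flip ((g.sharp b) (S.flip w)) v = T v ((g.sharp b) (S.flip w)) := rfl
  have e2 : S.flip w ((g.sharp b) (T v)) = S ((g.sharp b) (T v)) w := rfl
  rw [g.symm b v, val_sharp_apply, e1, ← val_sharp_apply g b (T v) ((g.sharp b) (S.flip w)),
    g.symm b ((g.sharp b) (T v)), val_sharp_apply, e2]

/-- **Contraction of a symmetric form with a form of prescribed symmetric part**: if `K` is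
symmetric and `B + Bᵗ = c K`, then `K^{ij} B_{ij} = (c/2) |K|²`, i.e.
`tr(♯K ∘ ♯B) = (c/2) normSq K`. (For Chruściel–Costa's (7.1), `B_{ij} = D_i Z_j`, `c = -2N`:
`K^{ij} D_i Z_j = -N |K|²`.) [cite: ONeill1983, Ch. 3, pp. 60–61] -/
theorem trace_sharp_comp_sharp_of_add_flip_eq {K B : LinearMap.BilinForm ℝ (E b)} {c : ℝ}
    (hK : K.flip = K) (hB : B + B.flip = c • K) :
    LinearMap.trace ℝ (E b) (((g.sharp b).toLinearMap ∘ₗ K) ∘ₗ ((g.sharp b).toLinearMap ∘ₗ B)) =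
      c / 2 * g.normSq b K := by
  haveI := VectorBundle.finiteDimensional ℝ F E b
  have h1 := g.trace_sharp_comp_sharp_eq_flip b K B
  rw [hK, LinearMap.trace_comp_comm' ((g.sharp b).toLinearMap ∘ₗ K)
    ((g.sharp b).toLinearMap ∘ₗ B.flip)] at h1
  -- `2 tr(♯K ♯B) = tr(♯K ♯(B + Bᵗ)) = c tr(♯K ♯K)`
  have h2 : LinearMap.trace ℝ (E b) (((g.sharp b).toLinearMap ∘ₗ K) ∘ₗ ((g.sharp b).toLinearMap ∘ₗ B)) +
      LinearMap.trace ℝ (E b) (((g.sharp b).toLinearMap ∘ₗ K) ∘ₗ ((g.sharp b).toLinearMap ∘ₗ B.flip)) =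
      c * LinearMap.trace ℝ (E b) (((g.sharp b).toLinearMap ∘ₗ K) ∘ₗ ((g.sharp b).toLinearMap ∘ₗ K)) := by
    rw [← map_add, ← LinearMap.comp_add, ← LinearMap.comp_add, hB, LinearMap.comp_smul,
      LinearMap.comp_smul, map_smul, smul_eq_mul]
  have h3 : g.normSq b K =
      LinearMap.trace ℝ (E b) (((g.sharp b).toLinearMap ∘ₗ K) ∘ₗ ((g.sharp b).toLinearMap ∘ₗ K)) := by
    rw [normSq, hK]
  rw [h3]
  linarith [h2, h1]

end PseudoRiemannianMetric

end Literature.Geometry.Lorentzian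

end
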